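import Mathlib.Algebra.Order.BigOperators.Group.Finset
import Mathlib.Algebra.BigOperators.Ring.Finset
import Mathlib.Algebra.Order.Ring.Int
import Mathlib.Data.List.Basic
import Mathlib.Tactic.Linarith
import Mathlib.Tactic.Ring
import Mathlib.Tactic.Positivity
import HarnessLib

/-!
# ω-census family (a): a kernel-checkable branch-and-bound certificate format for box-constrained integer systems

Cell `pub-omega` (unit `pub-omega-tensor-g7`), topic `Summits/MatrixMultiplication/OmegaCensus` (sub-folder
`SmallFormats`). Framing (verbatim): lottery ticket; floor = certified bounds/negative ranges. HONEST FRAMING: generic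
bookkeeping, no matrix multiplication content. PURPOSE: the X-cap counting systems of this folder (e.g. the slack-2 system over
`𝔽₅` behind "`R_𝔽₅(⟨2,2,n⟩) ≥ 3n+3` for `n ≥ 17`", decided exactly by an LP-steered branch-and-bound whose every pruned node
carries nonnegative rational multipliers) have NO single dual certificate (their LP relaxation exceeds the target), so a kernel
proof has to replay a branching tree. This file fixes the format and proves it sound once:

* the system: `N` variables `x j ∈ ℕ` in a box `lo j ≤ x j ≤ hi j`, and `M` rows `∑_{j<N} A r j · x j ≤ rhs r` (`A r j : ℤ`
  given through sparse COLUMN lists `col j : List (ℕ × ℤ)` of pairs `(r, a)`);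
* a certificate `Cert`: `leaf y` (multipliers `y : ℕ → ℕ`, read with a common denominator `D`), `infeasible r` (row `r` is
  violated on the whole box), `branch j v up down` (`x j ≥ v+1` / `x j ≤ v`);
* the checker `Cert.check` (pure `ℕ/ℤ` arithmetic, meant for `decide +kernel`) and its soundness `Cert.sum_lt_of_check`:
  if the check passes then every integer point of the box satisfying the rows has `∑ x j < T`.
The leaf test is weak duality in the Lagrangian form `∑_r y_r·rhs_r + ∑_j max over [lo_j, hi_j] of (D − ∑_r y_r A_rj)·x_j < D·T`,
valid for ANY `y ≥ 0` — so the multipliers need no provenance.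
-/

namespace Summit.MatrixMultiplication.OmegaCensus.SmallFormats.BoxCert

open Finset

/-- A box-constrained integer system: `N` variables, `M` rows, sparse columns, right-hand sides. -/
structure System where
  /-- number of variables -/
  N : ℕ
  /-- number of rows -/
  M : ℕ
  /-- column `j` as a list of `(row, coefficient)` -/
  col : ℕ → List (ℕ × ℤ)
  /-- right-hand side of row `r` -/
  rhs : ℕ → ℤ

variable (S : System)

/-- The coefficient `A r j`, read off the column list. -/
def System.A (r j : ℕ) : ℤ := ((S.col j).filter (fun e => e.1 = r)).foldr (fun e acc => e.2 + acc) 0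

/-- `x` satisfies the rows of `S`. -/
def System.Feasible (x : ℕ → ℕ) : Prop := ∀ r < S.M, ∑ j ∈ range S.N, S.A r j * (x j : ℤ) ≤ S.rhs r

/-- A box `lo ≤ x ≤ hi` recorded as a path of refinements `(j, lo_j, hi_j)` on top of the root box `[0, s]`. -/
def loOf (path : List (ℕ × ℕ × ℕ)) (j : ℕ) : ℕ :=
  match path.find? (fun e => e.1 = j) with
  | some e => e.2.1
  | none => 0

/-- Upper bounds of the box recorded by `path` (root box `[0, s]`). -/
def hiOf (s : ℕ) (path : List (ℕ × ℕ × ℕ)) (j : ℕ) : ℕ :=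
  match path.find? (fun e => e.1 = j) with
  | some e => e.2.2
  | none => s

/-- `x` lies in the box recorded by `path`. -/
def InBox (s : ℕ) (path : List (ℕ × ℕ × ℕ)) (x : ℕ → ℕ) : Prop := ∀ j, loOf path j ≤ x j ∧ x j ≤ hiOf s path j

/-- Branch-and-bound certificates. -/
inductive Cert where
  /-- pruned by multipliers `y` (numerators over the common denominator `D`) -/
  | leaf (y : ℕ → ℕ) : Cert
  /-- pruned because row `r` is violated by every point of the box -/
  | infeasible (r : ℕ) : Cert
  /-- split on `x j ≥ v + 1` (first child) versus `x j ≤ v` (second child) -/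
  | branch (j v : ℕ) (up down : Cert) : Cert

/-- `∑_{(r,a) ∈ col j} y_r · a` — the `j`-th entry of `yᵀA`. -/
def System.yA (y : ℕ → ℕ) (j : ℕ) : ℤ := ((S.col j).map fun e => (y e.1 : ℤ) * e.2).sum

/-- The leaf test (Lagrangian weak-duality bound `< D·T`). -/
def System.leafOK (D T s : ℕ) (y : ℕ → ℕ) (path : List (ℕ × ℕ × ℕ)) : Bool :=
  decide ((∑ r ∈ range S.M, (y r : ℤ) * S.rhs r)
    + (∑ j ∈ range S.N, (let c := (D : ℤ) - S.yA y j; if 0 < c then c * hiOf s path j else c * loOf path j))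
    < (D : ℤ) * T)

/-- The infeasible-row test: the minimum of row `r` over the box exceeds `rhs r`. -/
def System.rowInfeasible (s r : ℕ) (path : List (ℕ × ℕ × ℕ)) : Bool :=
  decide (S.rhs r < ∑ j ∈ range S.N, (if 0 < S.A r j then S.A r j * loOf path j else S.A r j * hiOf s path j))

/-- The certificate checker. -/
def Cert.check (D T s : ℕ) : Cert → List (ℕ × ℕ × ℕ) → Bool
  | .leaf y, path => S.leafOK D T s y path
  | .infeasible r, path => decide (r < S.M) && S.rowInfeasible s r path
  | .branch j v up dn, path =>
      decide (loOf path j ≤ v) && decide (v < hiOf s path j) &&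
        up.check D T s ((j, v + 1, hiOf s path j) :: path) && dn.check D T s ((j, loOf path j, v) :: path)

/-! ## Soundness -/

/-- Lower bound at the refined index. -/
theorem loOf_cons_self (j a b : ℕ) (path : List (ℕ × ℕ × ℕ)) : loOf ((j, a, b) :: path) j = a := by
  simp [loOf, List.find?]

/-- Upper bound at the refined index. -/
theorem hiOf_cons_self (s j a b : ℕ) (path : List (ℕ × ℕ × ℕ)) : hiOf s ((j, a, b) :: path) j = b := by
  simp [hiOf, List.find?]

/-- Lower bounds at other indices are unchanged by a refinement. -/
theorem loOf_cons_ne {j j' : ℕ} (h : j' ≠ j) (a b : ℕ) (path : List (ℕ × ℕ × ℕ)) :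
    loOf ((j, a, b) :: path) j' = loOf path j' := by
  simp [loOf, List.find?, Ne.symm h]

/-- Upper bounds at other indices are unchanged by a refinement. -/
theorem hiOf_cons_ne {j j' : ℕ} (h : j' ≠ j) (s a b : ℕ) (path : List (ℕ × ℕ × ℕ)) :
    hiOf s ((j, a, b) :: path) j' = hiOf s path j' := by
  simp [hiOf, List.find?, Ne.symm h]

/-- Refining the box at `j` upward keeps `x` inside if `x j ≥ v+1`. -/
theorem inBox_up {s : ℕ} {path : List (ℕ × ℕ × ℕ)} {x : ℕ → ℕ} (hx : InBox s path x) {j v : ℕ} (hv : v + 1 ≤ x j) :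
    InBox s ((j, v + 1, hiOf s path j) :: path) x := by
  intro j'
  by_cases h : j' = j
  · subst h; rw [loOf_cons_self, hiOf_cons_self]; exact ⟨hv, (hx j').2⟩
  · rw [loOf_cons_ne h, hiOf_cons_ne h]; exact hx j'

/-- Refining the box at `j` downward keeps `x` inside if `x j ≤ v`. -/
theorem inBox_down {s : ℕ} {path : List (ℕ × ℕ × ℕ)} {x : ℕ → ℕ} (hx : InBox s path x) {j v : ℕ} (hv : x j ≤ v) :
    InBox s ((j, loOf path j, v) :: path) x := by
  intro j'
  by_cases h : j' = j
  · subst h; rw [loOf_cons_self, hiOf_cons_self]; exact ⟨(hx j').1, hv⟩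
  · rw [loOf_cons_ne h, hiOf_cons_ne h]; exact hx j'

/-- Column-list well-formedness: every row index mentioned is `< M`. -/
def System.ColWF : Prop := ∀ j, ∀ e ∈ S.col j, e.1 < S.M

/-- `yᵀA` entry `j` equals `∑_{r<M} y_r · A r j` when the column list only mentions rows `< M`. -/
theorem System.yA_eq_sum (hwf : S.ColWF) (y : ℕ → ℕ) (j : ℕ) :
    S.yA y j = ∑ r ∈ range S.M, (y r : ℤ) * S.A r j := by
  unfold System.yA System.A
  have key : ∀ l : List (ℕ × ℤ), (∀ e ∈ l, e.1 < S.M) →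
      (l.map fun e => (y e.1 : ℤ) * e.2).sum
        = ∑ r ∈ range S.M, (y r : ℤ) * ((l.filter (fun e => e.1 = r)).foldr (fun e acc => e.2 + acc) 0) := by
    intro l hl
    induction l with
    | nil => simp
    | cons e t ih =>
      have he : e.1 < S.M := hl e (by simp)
      have ht : ∀ e' ∈ t, e'.1 < S.M := fun e' h => hl e' (by simp [h])
      rw [List.map_cons, List.sum_cons, ih ht]
      have hsplit : ∀ r ∈ range S.M, (y r : ℤ) * (((e :: t).filter (fun e' => e'.1 = r)).foldr (fun e' acc => e'.2 + acc) 0)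
          = (if r = e.1 then (y r : ℤ) * e.2 else 0)
            + (y r : ℤ) * ((t.filter (fun e' => e'.1 = r)).foldr (fun e' acc => e'.2 + acc) 0) := by
        intro r _
        by_cases h : e.1 = r
        · subst h; simp [mul_add]
        · have h' : ¬ r = e.1 := fun h2 => h h2.symm
          simp [h, h']
      rw [sum_congr rfl hsplit, sum_add_distrib, sum_ite_eq' (range S.M) e.1, if_pos (mem_range.2 he)]
  exact key _ (hwf j)

/-- **Leaf soundness** (weak duality): if the leaf test passes, every feasible point of the box has `∑ x j < T`. -/
theorem System.sum_lt_of_leafOK (hwf : S.ColWF) {D T s : ℕ} {y : ℕ → ℕ} {path : List (ℕ × ℕ × ℕ)}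
    (h : S.leafOK D T s y path = true) {x : ℕ → ℕ} (hbox : InBox s path x) (hfeas : S.Feasible x) :
    ∑ j ∈ range S.N, x j < T := by
  unfold System.leafOK at h
  have hlt := of_decide_eq_true h
  -- (1)  D·∑x = ∑_j c_j x_j + ∑_j (yA)_j x_j
  have hsplit : (D : ℤ) * ∑ j ∈ range S.N, (x j : ℤ)
      = ∑ j ∈ range S.N, ((D : ℤ) - S.yA y j) * x j + ∑ j ∈ range S.N, S.yA y j * x j := by
    rw [← sum_add_distrib, mul_sum]
    exact sum_congr rfl fun j _ => by ring
  -- (2)  ∑_j (yA)_j x_j = ∑_r y_r (∑_j A r j x_j) ≤ ∑_r y_r rhs_r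
  have hdual : ∑ j ∈ range S.N, S.yA y j * (x j : ℤ) ≤ ∑ r ∈ range S.M, (y r : ℤ) * S.rhs r := by
    have e1 : ∑ j ∈ range S.N, S.yA y j * (x j : ℤ)
        = ∑ r ∈ range S.M, (y r : ℤ) * ∑ j ∈ range S.N, S.A r j * (x j : ℤ) := by
      simp_rw [S.yA_eq_sum hwf, sum_mul, mul_sum]
      rw [sum_comm]
      exact sum_congr rfl fun r _ => sum_congr rfl fun j _ => by ring
    rw [e1]
    exact sum_le_sum fun r hr => mul_le_mul_of_nonneg_left (hfeas r (mem_range.1 hr)) (by positivity)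
  -- (3)  c_j x_j ≤ its maximum over [lo_j, hi_j]
  have hbox' : ∑ j ∈ range S.N, ((D : ℤ) - S.yA y j) * x j
      ≤ ∑ j ∈ range S.N, (let c := (D : ℤ) - S.yA y j; if 0 < c then c * hiOf s path j else c * loOf path j) := by
    refine sum_le_sum fun j _ => ?_
    obtain ⟨hlo, hhi⟩ := hbox j
    simp only
    split_ifs with hc
    · exact mul_le_mul_of_nonneg_left (by exact_mod_cast hhi) hc.le
    · exact mul_le_mul_of_nonpos_left (by exact_mod_cast hlo) (not_lt.1 hc)
  -- combine
  have hD : (D : ℤ) * ∑ j ∈ range S.N, (x j : ℤ) < (D : ℤ) * T := by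
    rw [hsplit]; linarith
  have hD0 : 0 < D := by
    rcases Nat.eq_zero_or_pos D with h0 | h0
    · subst h0; simp at hD
    · exact h0
  have : (∑ j ∈ range S.N, (x j : ℤ)) < T := lt_of_mul_lt_mul_left hD (by positivity)
  exact_mod_cast this

/-- **Infeasible-row soundness**: no feasible point lies in the box. -/
theorem System.false_of_rowInfeasible {s r : ℕ} (hr : r < S.M) {path : List (ℕ × ℕ × ℕ)}
    (h : S.rowInfeasible s r path = true) {x : ℕ → ℕ} (hbox : InBox s path x) (hfeas : S.Feasible x) : False := by
  unfold System.rowInfeasible at h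
  have hlt := of_decide_eq_true h
  have hle : ∑ j ∈ range S.N, (if 0 < S.A r j then S.A r j * (loOf path j : ℤ) else S.A r j * (hiOf s path j : ℤ))
      ≤ ∑ j ∈ range S.N, S.A r j * (x j : ℤ) := by
    refine sum_le_sum fun j _ => ?_
    obtain ⟨hlo, hhi⟩ := hbox j
    split_ifs with hc
    · exact mul_le_mul_of_nonneg_left (by exact_mod_cast hlo) hc.le
    · exact mul_le_mul_of_nonpos_left (by exact_mod_cast hhi) (not_lt.1 hc)
  have := hfeas r hr
  linarith

/-- **Soundness of the certificate checker.** -/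
theorem Cert.sum_lt_of_check (hwf : S.ColWF) {D T s : ℕ} :
    ∀ (c : Cert) (path : List (ℕ × ℕ × ℕ)), c.check S D T s path = true →
      ∀ x : ℕ → ℕ, InBox s path x → S.Feasible x → ∑ j ∈ range S.N, x j < T
  | .leaf y, path, h, x, hbox, hfeas => S.sum_lt_of_leafOK hwf (by simpa [Cert.check] using h) hbox hfeas
  | .infeasible r, path, h, x, hbox, hfeas => by
      simp only [Cert.check, Bool.and_eq_true, decide_eq_true_eq] at h
      exact (S.false_of_rowInfeasible h.1 h.2 hbox hfeas).elim
  | .branch j v up dn, path, h, x, hbox, hfeas => by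
      simp only [Cert.check, Bool.and_eq_true, decide_eq_true_eq] at h
      obtain ⟨⟨⟨_, _⟩, hup⟩, hdn⟩ := h
      rcases Nat.lt_or_ge v (x j) with hv | hv
      · exact Cert.sum_lt_of_check hwf up _ hup x (inBox_up hbox hv) hfeas
      · exact Cert.sum_lt_of_check hwf dn _ hdn x (inBox_down hbox hv) hfeas

/-- The root box `[0, s]^N`: `InBox s []`. -/
theorem inBox_nil {s : ℕ} {x : ℕ → ℕ} (hx : ∀ j, x j ≤ s) : InBox s [] x := fun j => ⟨Nat.zero_le _, by simpa [hiOf] using hx j⟩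

/-- **Root form**: a passing certificate at the root box bounds every feasible `x ≤ s` by `∑_{j<N} x j < T`. -/
theorem Cert.sum_lt_of_check_root (hwf : S.ColWF) {D T s : ℕ} (c : Cert) (h : c.check S D T s [] = true)
    (x : ℕ → ℕ) (hx : ∀ j, x j ≤ s) (hfeas : S.Feasible x) : ∑ j ∈ range S.N, x j < T :=
  Cert.sum_lt_of_check S hwf c [] h x (inBox_nil hx) hfeas

/-! ## A toy instance (format check): `x₀ + x₁ ≤ 1`, box `[0,1]²`, claim `∑ < 2`, one leaf with `y₀ = 1`, `D = 1`. -/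

/-- Toy system: one row `x₀ + x₁ ≤ 1`. -/
def toy : System := ⟨2, 1, fun j => if j < 2 then [(0, 1)] else [], fun _ => 1⟩

/-- The toy certificate passes. -/
example : (Cert.leaf fun _ => 1).check toy 1 2 1 [] = true := by decide +kernel

end Summit.MatrixMultiplication.OmegaCensus.SmallFormats.BoxCert
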